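import Summits.HodgeConjecture.HodgeCM.Model.TowerCarrier
import HarnessLib

/-!
# The level-`K` carrier `H_K` of the PIN tower read on representatives: stabilisers act trivially, and an equivariant family is
# freely determined by its values at representatives of `U(V)(L₀)\U(V)(𝔸_{L₀,f})/K`

Cell `hodgecm-mathlib` (D-0151), fan A, rung A-III, line `a3-liu418` (v3 1b96ade3f8b6b529 → v4), GAP 1 `stub_pinBettiPinning` (director g1
02:56:13Z; PREP memo `A-provers/A-p18/PREP-GAP1-pinBettiPinning.md`, piece (π1), file 1 «TowerLevelRepresentatives»).  Seat A-p18.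

The PIN's level object `towerLevel … Γ hΓ ⊆ Π h, H¹(P_{Γ_h}; ℚ) ⊗ ℂ` (`Model/TowerLevel_1`) is the module of `U(V)(L₀)`-EQUIVARIANT FAMILIES
`c h = t_γ^* c(h')` whenever `h' = (γ)_f h k` — Liu's / Deligne's `H¹(X_K(ℂ); ℂ)` for `X_K(ℂ) = U(V)(L₀)\(𝔹 × U(V)(𝔸_f)/K) = ⊔_{[h]} Γ_h\𝔹`
written WITHOUT representatives.  To compare it with the canonical model's `H¹` (a finite coproduct over representatives `g_q` of the class set,
clause (C2c) `pieces` of `UnitaryCanonicalModel.ComplexRecord`) one needs the two facts proved here, both over the model universe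
`universeOf hHD hI hU h₃` and its chosen translates `t_γ = transMor …` (`Model/LevelTranslate`), for every hermitian space `V` and level `Δ`/`Γ`:

* §1 `pull_transMor_of_mem` / `pullC_transMorU_of_mem` / `trPull_of_mem` — **STABILISERS ACT TRIVIALLY**: for `γ ∈ Δ.Γ` (the arithmetic group
  of the level itself) the translate `t_γ : P_Δ ⟶ P_Δ` induces the IDENTITY on `H^k(P_Δ(ℂ); ℚ)` (and on `⊗ ℂ`): on complex points `t_γ [v] = [γ^{ι₁} v] = [v]`
  because `γ^{ι₁}` lies in the uniformising group of the chosen ball datum (`ballDatum_map_Γ`, `unif_eq_unif_iff`), and Betti pull-back only sees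
  complex points (`pull_congr`, `map_eq_of_unif`).
* §2 `towerLevel` on representatives: the evaluation `c ↦ (c (q.out))_q` at the `Quotient.out` representatives of the double classes
  `q ∈ U(V)(L₀)\U(V)(𝔸_f)/K` (`DoubleCoset.Quotient (ρ V).range Γ.K`) is INJECTIVE (`eval_injective`, A-p09's argument in `finite_towerLevel`) and
  SURJECTIVE (`eval_surjective`): a prescribed family of values `x_q ∈ H¹(P_{Γ_{q.out}})` extends to the equivariant family
  `c h := t_γ^* x_q` (`h ∼ q.out` through `γ`), well defined and equivariant because two rational elements relating `h` to the same
  representative differ by an element of the stabiliser `Γ_h`, which acts trivially (§1) — packaged as the linear equivalence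
  `evalEquiv : towerLevel … Γ hΓ ≃ₗ[ℂ] Π q, H¹(P_{Γ_{q.out}}) ⊗ ℂ` (`evalEquiv_apply`).

Everything is a theorem over the PIN's standing hypotheses `(hHD, hI, hU, h₃, hA)` (they parametrise the carriers; nothing is assumed as proved);
no definition of mathematical content beyond the evaluation maps, no named fact, debt 0.  HC_CM is proved only modulo the 7 printed citations until
rung 0 closes; this file discharges none of them (it is bookkeeping for GAP 1 of the `hLiu418` line).

References: [Deligne1979ShimuraVarieties] P. Deligne, *Variétés de Shimura*, Proc. Symp. Pure Math. 33 (1979), 2.1.2 (the disjoint-sum description of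
`_K M_ℂ(G,X)`); [Liu2021] Y. Liu, Camb. J. Math. 9 (2021), §4.2 (FJcycle.tex l. 2062–2081); [BergeronMillsonMoeglin2016Balls] Introduction §1.1.
-/

noncomputable section

open scoped Matrix
open Matrix Function Set
open NumberField CategoryTheory
open Literature.AlgebraicGeometry.Motives
open Literature.AlgebraicGeometry.ShimuraVarieties
open Literature.AlgebraicGeometry.HodgeTheory
open Literature.NumberTheory.Automorphic
open Literature.NumberTheory.Automorphic.PicardCM
open Literature.NumberTheory.Transcendental (Arapura2012_Cor_15_4_6)

namespace HodgeCM

/-! ## §1 Stabilisers act trivially: `t_γ^* = id` for `γ ∈ Δ.Γ` -/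

namespace Model.LevelTranslate

variable (hU : BallQuotientUniformisedDatum) (h₃ : CMAbelianVarietyRealised)
variable (hHD : exists_isReal_hodgeModel) (hA : Arapura2012_Cor_15_4_6)
variable {L : CMField} {ι₁ : L →+* ℂ} {V : HermSpace3 L ι₁}

/-- On complex points the translate by an element `γ ∈ Δ.Γ` of the level itself is the identity of `P_Δ(ℂ) = Γ_Δ\𝔹`: `[γ^{ι₁} v] = [v]`
(`γ^{ι₁}` belongs to the uniformising group of the chosen ball datum, `ballDatum_map_Γ`; fibres of `unif` are the `Γ·ℂˣ`-orbits,
`unif_eq_unif_iff`). [cite: BergeronMillsonMoeglin2016Balls, Introduction §1.1] -/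
theorem map_transMor_eq_self_of_mem {Δ : Level V} {γ : GL (Fin 3) L} (hγΔ : γ ∈ Δ.Γ) (ht : TransCond γ Δ Δ)
    (P : ComplexPoints (Var.scheme hU h₃ (.pms (pmsCode L ι₁ V Δ)))) :
    AlgPoints.map (transMor hU h₃ hHD hA (Δ.Γ_le_rational hγΔ) Δ Δ ht) P = P := by
  by_cases h : IsAnisotropic L V.Hm
  · have h₁ := (isAnisotropic_pmsCode_iff L ι₁ V Δ).2 h
    rw [← AlgPoints.map_id_apply (L := ℂ) P]
    refine map_eq_of_unif hU h₃ h₁ (fun v hv ↦ ?_) P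
    rw [map_transMor_unif hU h₃ hHD hA _ ht h hv, AlgPoints.map_id_apply]
    set D := Var.ballDatum hU h₃ (pmsCode L ι₁ V Δ) h₁ with hD
    -- `γ^{ι₁} = γ'^{τ₁}` for some `γ'` of the datum's group
    have hmem : glι ι₁ γ ∈ D.Γ.map (Matrix.GeneralLinearGroup.map D.τ₁) := by
      rw [hD, ballDatum_map_Γ hU h₃ Δ h₁]
      exact Subgroup.mem_map_of_mem _ hγΔ
    obtain ⟨γ', hγ', hγ'eq⟩ := Subgroup.mem_map.mp hmem
    have hv' : (glι ι₁ γ : Matrix (Fin 3) (Fin 3) ℂ) *ᵥ v ∈ D.cone :=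
      LevelCoveringTwist.mulVec_mem_cone (Model.ballDatum_Hℂ_eq hU h₃ Δ Δ h₁ h₁)
        (map_ι₁_mem_realPoints hU h₃ (Δ.Γ_le_rational hγΔ) Δ h₁) hv
    refine ((D.unif_eq_unif_iff v hv _ hv').2 ⟨γ', hγ', 1, one_ne_zero, ?_⟩).symm
    rw [one_smul, ← hγ'eq]
    rfl
  · -- off the anisotropic regime the translate is an `eqToHom` of `ℙ²`, the identity
    unfold transMor
    simp only [dif_neg h, eqToHom_refl, AlgPoints.map_id_apply]

/-- **`t_γ^* = id` on `H^k(P_Δ(ℂ); ℚ)` for `γ ∈ Δ.Γ`** (Betti pull-back only sees complex points, `pull_congr`).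
[cite: BergeronMillsonMoeglin2016Balls, Introduction §1.1] -/
theorem pull_transMor_of_mem {Δ : Level V} {γ : GL (Fin 3) L} (hγΔ : γ ∈ Δ.Γ) (ht : TransCond γ Δ Δ) (k : ℕ) :
    BettiUniverse.pull (transMor hU h₃ hHD hA (Δ.Γ_le_rational hγΔ) Δ Δ ht) k = LinearMap.id := by
  rw [← BettiUniverse.pull_id]
  exact pull_congr (fun P ↦ by rw [map_transMor_eq_self_of_mem hU h₃ hHD hA hγΔ ht P, AlgPoints.map_id_apply]) k

variable (hI : hodgePQ_independent_of_hodgeModel)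

/-- **`t_γ^* = id` on `U.CohC (U.pms L ι₁ V Δ) k = H^k(P_Δ(ℂ); ℚ) ⊗ ℂ` for `γ ∈ Δ.Γ`**, for any membership proof `hγ : γ ∈ U(V)(L₀)`.
[cite: BergeronMillsonMoeglin2016Balls, Introduction §1.1] -/
theorem pullC_transMorU_of_mem {Δ : Level V} {γ : GL (Fin 3) L} (hγΔ : γ ∈ Δ.Γ) (hγ : γ ∈ Urat V) (ht : TransCond γ Δ Δ) (k : ℕ) :
    (universeOf hHD hI hU h₃).pullC (transMorU hU h₃ hHD hI hA hγ Δ Δ ht) k = LinearMap.id := by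
  rw [pullC_transMorU_congr hU h₃ hHD hI hA hγ (Δ.Γ_le_rational hγΔ) rfl ht ht, pullC_transMorU,
    pull_transMor_of_mem hU h₃ hHD hA hγΔ ht k, LinearMap.baseChange_id]
  rfl

end Model.LevelTranslate

namespace Model.TowerLevel

open HodgeCM.Model.LevelTranslate

variable (hHD : exists_isReal_hodgeModel) (hI : hodgePQ_independent_of_hodgeModel)
  (hU : BallQuotientUniformisedDatum) (h₃ : CMAbelianVarietyRealised) (hA : Arapura2012_Cor_15_4_6)
variable {L : CMField} {ι₁ : L →+* ℂ} {V : HermSpace3 L ι₁}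

/-- **Stabilisers act trivially on the tower's coefficients**: `trPull γ Δ Δ _ k x = x` for a rational `γ : Urat V` lying in `Δ.Γ`.
[cite: BergeronMillsonMoeglin2016Balls, Introduction §1.1] -/
theorem trPull_of_mem {Δ : Level V} {γ : ↥(Urat V)} (hγΔ : (γ : GL (Fin 3) L) ∈ Δ.Γ)
    (ht : TransCond (γ : GL (Fin 3) L) Δ Δ) (k : ℕ) (x : Coh hHD hI hU h₃ Δ k) :
    trPull hHD hI hU h₃ hA γ Δ Δ ht k x = x := by
  have := pullC_transMorU_of_mem hU h₃ hHD hA hI hγΔ γ.2 ht k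
  exact congrArg (fun f : Coh hHD hI hU h₃ Δ k →ₗ[ℂ] Coh hHD hI hU h₃ Δ k ↦ f x) this

/-! ## §2 `H_K` on representatives of `U(V)(L₀)\U(V)(𝔸_f)/K` -/

section Representatives

variable (Γ : Level V) (hΓ : Γ.BelowConjThree)

/-- The class set `U(V)(L₀)\U(V)(𝔸_{L₀,f})/K` in the currency of the tower (double classes of `(ρ V).range` and `Γ.K`). [cite: Deligne1979ShimuraVarieties, 2.1.2] -/
abbrev ClassSet : Type :=
  DoubleCoset.Quotient (((ρ V).range : Subgroup V.adelicFin) : Set V.adelicFin) (Γ.K : Set V.adelicFin)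

/-- **Evaluation at the representatives** `q.out` of the double classes: `c ↦ (c (q.out))_q`. [cite: Deligne1979ShimuraVarieties, 2.1.2] -/
def eval : towerLevel hHD hI hU h₃ hA Γ hΓ →ₗ[ℂ] (∀ q : ClassSet Γ, W hHD hI hU h₃ Γ hΓ q.out) where
  toFun c q := (c : Π h, W hHD hI hU h₃ Γ hΓ h) q.out
  map_add' _ _ := rfl
  map_smul' _ _ := rfl

/-- unfolding of `eval`. [folklore] -/
@[simp] theorem eval_apply (c : towerLevel hHD hI hU h₃ hA Γ hΓ) (q : ClassSet Γ) :
    eval hHD hI hU h₃ hA Γ hΓ c q = (c : Π h, W hHD hI hU h₃ Γ hΓ h) q.out := rfl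

variable {Γ}

/-- Every index `h` is related to the representative of its class: `q.out = (γ)_f h k`. [cite: Deligne1979ShimuraVarieties, 2.1.2] -/
theorem exists_rel_out (h : V.adelicFin) :
    ∃ γ : ↥(Urat V), Rel Γ γ h (DoubleCoset.mk ((ρ V).range) Γ.K h : ClassSet Γ).out := by
  obtain ⟨γ', k, hγ', hk, hout⟩ := DoubleCoset.mk_out_eq_mul ((ρ V).range) Γ.K h
  obtain ⟨γ, rfl⟩ := MonoidHom.mem_range.mp hγ'
  exact ⟨γ, k, hk, hout⟩

/-- **An equivariant family is determined by its values at the representatives** (A-p09, `finite_towerLevel`): `eval` is injective.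
[cite: Deligne1979ShimuraVarieties, 2.1.2] -/
theorem eval_injective : Function.Injective (eval hHD hI hU h₃ hA Γ hΓ) := by
  intro c d hcd
  apply Subtype.ext
  funext h
  obtain ⟨γ, r⟩ := exists_rel_out (Γ := Γ) h
  have hq := congrFun hcd (DoubleCoset.mk ((ρ V).range) Γ.K h)
  simp only [eval_apply] at hq
  rw [apply_eq_trPull hHD hI hU h₃ hA c r (transCond_of_rel hΓ r), apply_eq_trPull hHD hI hU h₃ hA d r (transCond_of_rel hΓ r), hq]

/-- Two rational elements relating the same index `h` to the same index `h'` differ by an element of the stabiliser `Γ_h`, so their pull-backs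
`H¹(P_{h'}) → H¹(P_h)` AGREE (§1). [cite: BergeronMillsonMoeglin2016Balls, Introduction §1.1] -/
theorem trPull_eq_trPull_of_rel {γ₁ γ₂ : ↥(Urat V)} {h h' : V.adelicFin} (r₁ : Rel Γ γ₁ h h') (r₂ : Rel Γ γ₂ h h')
    (ht₁ : TransCond (γ₁ : GL (Fin 3) L) (Γ.conj h hΓ) (Γ.conj h' hΓ)) (ht₂ : TransCond (γ₂ : GL (Fin 3) L) (Γ.conj h hΓ) (Γ.conj h' hΓ))
    (x : W hHD hI hU h₃ Γ hΓ h') :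
    trPull hHD hI hU h₃ hA γ₁ (Γ.conj h hΓ) (Γ.conj h' hΓ) ht₁ 1 x = trPull hHD hI hU h₃ hA γ₂ (Γ.conj h hΓ) (Γ.conj h' hΓ) ht₂ 1 x := by
  -- `ε := γ₁⁻¹ γ₂` stabilises the class of `h`: `(ε)_f = h (k₁ k₂⁻¹) h⁻¹`
  obtain ⟨k₁, hk₁, e₁⟩ := r₁
  obtain ⟨k₂, hk₂, e₂⟩ := r₂
  set ε : ↥(Urat V) := γ₁⁻¹ * γ₂ with hε
  have hεΓ : (ε : GL (Fin 3) L) ∈ (Γ.conj h hΓ).Γ := by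
    rw [Level.mem_conj_Γ_iff]
    refine ⟨ε.2, k₁ * k₂⁻¹, Γ.K.mul_mem hk₁ (Γ.K.inv_mem hk₂), ?_⟩
    have hρ : ρ V ε = (ρ V γ₁)⁻¹ * ρ V γ₂ := by rw [hε, map_mul, map_inv]
    have e3 : h * k₁ = (ρ V γ₁)⁻¹ * h' := by rw [e₁]; group
    have e4 : h * k₂ = (ρ V γ₂)⁻¹ * h' := by rw [e₂]; group
    have : h * (k₁ * k₂⁻¹) * h⁻¹ = (ρ V γ₁)⁻¹ * ρ V γ₂ := by
      calc h * (k₁ * k₂⁻¹) * h⁻¹ = (h * k₁) * (h * k₂)⁻¹ := by group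
        _ = ((ρ V γ₁)⁻¹ * h') * ((ρ V γ₂)⁻¹ * h')⁻¹ := by rw [e3, e4]
        _ = (ρ V γ₁)⁻¹ * ρ V γ₂ := by group
    rw [this, ← hρ]
  have htε : TransCond (ε : GL (Fin 3) L) (Γ.conj h hΓ) (Γ.conj h hΓ) :=
    (TransCond.iff).2 fun δ hδ ↦ (Γ.conj h hΓ).Γ.mul_mem ((Γ.conj h hΓ).Γ.mul_mem hεΓ hδ) ((Γ.conj h hΓ).Γ.inv_mem hεΓ)
  have e : γ₂ = γ₁ * ε := by rw [hε, mul_inv_cancel_left]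
  rw [← trPull_trPull hHD hI hU h₃ hA e htε ht₁ ht₂ 1 x, trPull_of_mem hHD hI hU h₃ hA hεΓ htε]

/-- The extension of prescribed values at the representatives to all indices: `c h := t_γ^* x_{[h]}` for the chosen `γ` with `[h].out = (γ)_f h k`.
[cite: Deligne1979ShimuraVarieties, 2.1.2] -/
def extend (x : ∀ q : ClassSet Γ, W hHD hI hU h₃ Γ hΓ q.out) (h : V.adelicFin) : W hHD hI hU h₃ Γ hΓ h :=
  trPull hHD hI hU h₃ hA (exists_rel_out (Γ := Γ) h).choose (Γ.conj h hΓ) (Γ.conj _ hΓ)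
    (transCond_of_rel hΓ (exists_rel_out (Γ := Γ) h).choose_spec) 1 (x (DoubleCoset.mk ((ρ V).range) Γ.K h))

/-- The extension computed through ANY relating element. [cite: Deligne1979ShimuraVarieties, 2.1.2] -/
theorem extend_eq (x : ∀ q : ClassSet Γ, W hHD hI hU h₃ Γ hΓ q.out) (h : V.adelicFin) {γ : ↥(Urat V)}
    (r : Rel Γ γ h (DoubleCoset.mk ((ρ V).range) Γ.K h : ClassSet Γ).out)
    (ht : TransCond (γ : GL (Fin 3) L) (Γ.conj h hΓ) (Γ.conj (DoubleCoset.mk ((ρ V).range) Γ.K h : ClassSet Γ).out hΓ)) :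
    extend hHD hI hU h₃ hA hΓ x h = trPull hHD hI hU h₃ hA γ (Γ.conj h hΓ) (Γ.conj _ hΓ) ht 1 (x (DoubleCoset.mk ((ρ V).range) Γ.K h)) :=
  trPull_eq_trPull_of_rel hHD hI hU h₃ hA hΓ (exists_rel_out (Γ := Γ) h).choose_spec r _ ht _

/-- The extension is an EQUIVARIANT FAMILY. [cite: Deligne1979ShimuraVarieties, 2.1.2] -/
theorem extend_mem (x : ∀ q : ClassSet Γ, W hHD hI hU h₃ Γ hΓ q.out) :
    extend hHD hI hU h₃ hA hΓ x ∈ towerLevel hHD hI hU h₃ hA Γ hΓ := by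
  intro δ h h' r
  -- `h` and `h'` have the same class; relate `h'` to the representative by `γ'`, then `h` by `γ' δ`
  have hq : (DoubleCoset.mk ((ρ V).range) Γ.K h : ClassSet Γ) = DoubleCoset.mk ((ρ V).range) Γ.K h' := by
    obtain ⟨k, hk, e⟩ := r
    exact (DoubleCoset.eq _ _ _ _).mpr ⟨ρ V δ, ⟨δ, rfl⟩, k, hk, e⟩
  obtain ⟨γ', r'⟩ := exists_rel_out (Γ := Γ) h'
  have r₀ : Rel Γ (γ' * δ) h (DoubleCoset.mk ((ρ V).range) Γ.K h' : ClassSet Γ).out := by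
    obtain ⟨k, hk, e⟩ := r
    obtain ⟨k', hk', e'⟩ := r'
    refine ⟨k * k', Γ.K.mul_mem hk hk', ?_⟩
    rw [e', e, map_mul]
    group
  have r₀' : Rel Γ (γ' * δ) h (DoubleCoset.mk ((ρ V).range) Γ.K h : ClassSet Γ).out := by rw [hq]; exact r₀
  rw [extend_eq hHD hI hU h₃ hA hΓ x h r₀' (transCond_of_rel hΓ r₀'),
    extend_eq hHD hI hU h₃ hA hΓ x h' r' (transCond_of_rel hΓ r'),
    trPull_trPull hHD hI hU h₃ hA rfl (transCond_of_rel hΓ r) (transCond_of_rel hΓ r') (transCond_of_rel hΓ r₀)]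
  -- both sides are `t_{γ'δ}^*` of the representative value, across the equality of classes `hq`
  -- transport along `hq` (the representative, the value `x _` and the TransCond proofs depend on the class)
  have key : ∀ (q q' : ClassSet Γ) (e : q = q') (htq : TransCond ((γ' * δ : ↥(Urat V)) : GL (Fin 3) L) (Γ.conj h hΓ) (Γ.conj q.out hΓ))
      (htq' : TransCond ((γ' * δ : ↥(Urat V)) : GL (Fin 3) L) (Γ.conj h hΓ) (Γ.conj q'.out hΓ)),
      trPull hHD hI hU h₃ hA (γ' * δ) (Γ.conj h hΓ) (Γ.conj q.out hΓ) htq 1 (x q) =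
        trPull hHD hI hU h₃ hA (γ' * δ) (Γ.conj h hΓ) (Γ.conj q'.out hΓ) htq' 1 (x q') := by
    intro q q' e htq htq'
    subst e
    rfl
  exact key _ _ hq _ _

/-- **`eval` is surjective**: every family of values at the representatives extends to an equivariant family. [cite: Deligne1979ShimuraVarieties, 2.1.2] -/
theorem eval_surjective : Function.Surjective (eval hHD hI hU h₃ hA Γ hΓ) := by
  intro x
  refine ⟨⟨extend hHD hI hU h₃ hA hΓ x, extend_mem hHD hI hU h₃ hA hΓ x⟩, funext fun q ↦ ?_⟩
  rw [eval_apply]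
  -- at a representative `h = q.out` the class is `q` and `γ = 1` relates `h` to itself
  have hq : (DoubleCoset.mk ((ρ V).range) Γ.K q.out : ClassSet Γ) = q := q.out_eq
  have r : Rel Γ 1 q.out (DoubleCoset.mk ((ρ V).range) Γ.K q.out : ClassSet Γ).out := by rw [hq]; exact Rel.refl _
  change extend hHD hI hU h₃ hA hΓ x q.out = x q
  rw [extend_eq hHD hI hU h₃ hA hΓ x q.out r (transCond_of_rel hΓ r)]
  have key : ∀ (q' : ClassSet Γ) (e : q' = q) (ht : TransCond ((1 : ↥(Urat V)) : GL (Fin 3) L) (Γ.conj q.out hΓ) (Γ.conj q'.out hΓ)),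
      trPull hHD hI hU h₃ hA 1 (Γ.conj q.out hΓ) (Γ.conj q'.out hΓ) ht 1 (x q') = x q := by
    intro q' e ht
    subst e
    exact trPull_one_self hHD hI hU h₃ hA ht 1 _
  exact key _ hq _

/-- **`H_K` on representatives**: `towerLevel … Γ hΓ ≃ₗ[ℂ] Π_{q ∈ U(L₀)\U(𝔸_f)/K} H¹(P_{Γ_{q.out}}; ℚ) ⊗ ℂ`, the evaluation at the `Quotient.out`
representatives (Deligne 2.1.2: `_K M_ℂ = ⊔_q Γ_{g_q}\X⁺`). [cite: Deligne1979ShimuraVarieties, 2.1.2] -/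
def evalEquiv : towerLevel hHD hI hU h₃ hA Γ hΓ ≃ₗ[ℂ] (∀ q : ClassSet Γ, W hHD hI hU h₃ Γ hΓ q.out) :=
  LinearEquiv.ofBijective (eval hHD hI hU h₃ hA Γ hΓ) ⟨eval_injective hHD hI hU h₃ hA hΓ, eval_surjective hHD hI hU h₃ hA hΓ⟩

/-- unfolding of `evalEquiv`. [folklore] -/
@[simp] theorem evalEquiv_apply (c : towerLevel hHD hI hU h₃ hA Γ hΓ) (q : ClassSet Γ) :
    evalEquiv hHD hI hU h₃ hA hΓ c q = (c : Π h, W hHD hI hU h₃ Γ hΓ h) q.out := rfl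

end Representatives

end Model.TowerLevel

end HodgeCM

end
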